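import Mathlib
import Summits.NavierStokesRegularity.NavierStokesRegularity.Theorems.EulerZoomLiouvillePowerGaugeEulerLiouvilleBallisticOrbitIdentities
import HarnessLib

/-!
# Crux E `PowerGaugeEulerLiouville` (stmt-NavierStokesRegularity-19832): FREE FLIGHT ALONG SIMILARITY ORBITS
# (crux idea «ballistic-faces», ns-idea-11 g7, law B5; width seat ns-ezl-w3 g5, T1 base)

Route №10 `EulerZoomLiouville` (NavierStokesRegularity), crux E.  For a `C²` self-similar Euler profile `(U, P)` (CIV (3.3), centre `0`, rate `γ`)
and a forward orbit `Y′ = W(Y)` of the similarity field `W = γy + U`, on an arc where the pressure force vanishes (`∇P(Y(s)) = 0`) the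
motion is explicit — the two characteristic rates of `Ÿ = −(1−2γ)Ẏ + γ(1−γ)Y` are `γ` (passive drift) and `γ − 1` (free fall):

* `hasDerivAt_velocity_orbit` — `d/ds U(Y) = −(1−γ)U(Y) − ∇P(Y)` along any forward orbit (the profile equation read along the flow);
* `freeFlight_mode_drift`, `freeFlight_mode_fall` — on a free arc, `e^{−γs}(Y + U(Y))` and `e^{(1−γ)s}U(Y)` are constant;
* **`freeFlight`** (B5) — `Y(s) = e^{γs}(Y(0) + U(Y(0))) − e^{(γ−1)s} U(Y(0))` for every `s` of the free arc (an open interval containing `0`).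

WHAT THIS IS NOT: not NS regularity, not the crux E, no stub — portrait identities for the T1/T2 faces of `Sig.stub_selfSimilarC2Needle`
(the «oblique hop» template of the card); `--supports` stmt-19832; 19832 OPEN; MODEL lattice, not E.
[cite: ConstantinIgnatovaVicol2026Putative, §3.1.1 eq. (3.3), §3.4 eq. (3.19)]
-/

noncomputable section

-- flat `Theorems/<Route><Decl>…` files of one crux share the namespace of the crux (tree convention: `Summit.<S>.<S>.…`)
set_option linter.dupNamespace false

open Set Filter Topology InnerProductSpace Metric
open scoped RealInnerProductSpace

namespace Summit.NavierStokesRegularity.NavierStokesRegularity.Theorems.PowerGaugeEulerLiouville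

namespace Ballistic

open Literature.Analysis Literature.Analysis.FluidPDE

variable {γ : ℝ} {U : EuclideanSpace ℝ (Fin 3) → EuclideanSpace ℝ (Fin 3)} {P : EuclideanSpace ℝ (Fin 3) → ℝ}

/-- **The profile velocity along a forward orbit**: if `Y′(s) = W(Y(s))` then `d/ds U(Y(s)) = −(1−γ) U(Y(s)) − ∇P(Y(s))` (CIV (3.3) read
along the similarity flow). [cite: ConstantinIgnatovaVicol2026Putative, §3.1.1 eq. (3.3)] -/
theorem hasDerivAt_velocity_orbit (h : IsSelfSimilarEulerProfile γ 0 U P) {Y : ℝ → EuclideanSpace ℝ (Fin 3)} {s : ℝ}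
    (hY : HasDerivAt Y (selfSimilarTransport γ 0 U (Y s)) s) :
    HasDerivAt (fun t => U (Y t)) (-((1 - γ) • U (Y s)) - gradient P (Y s)) s := by
  have h1 := (h.differentiable_velocity (Y s)).hasFDerivAt.comp_hasDerivAt s hY
  have e := h.profile_eq_transport (Y s)
  have hDU : fderiv ℝ U (Y s) (selfSimilarTransport γ 0 U (Y s)) = -((1 - γ) • U (Y s)) - gradient P (Y s) := by
    rw [sub_eq_add_neg, ← neg_add, eq_neg_iff_add_eq_zero]
    convert e using 1
    abel
  rw [hDU] at h1
  exact h1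

/-- **Free flight, drift mode**: on an open interval where `∇P(Y) = 0`, `e^{−γs} (Y(s) + U(Y(s)))` is constant (`Z₁ = Y + U(Y) = Ẏ − (γ−1)Y`
satisfies `Ż₁ = γ Z₁`). [folklore] -/
theorem freeFlight_mode_drift (h : IsSelfSimilarEulerProfile γ 0 U P) {Y : ℝ → EuclideanSpace ℝ (Fin 3)} {a b : ℝ}
    (hY : ∀ s ∈ Ioo a b, HasDerivAt Y (selfSimilarTransport γ 0 U (Y s)) s) (hfree : ∀ s ∈ Ioo a b, gradient P (Y s) = 0)
    {s t : ℝ} (hs : s ∈ Ioo a b) (ht : t ∈ Ioo a b) :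
    Real.exp (-(γ * s)) • (Y s + U (Y s)) = Real.exp (-(γ * t)) • (Y t + U (Y t)) := by
  have hderiv : ∀ r ∈ Ioo a b, HasDerivAt (fun r => Real.exp (-(γ * r)) • (Y r + U (Y r))) 0 r := by
    intro r hr
    have hZ : HasDerivAt (fun r => Y r + U (Y r)) (γ • (Y r + U (Y r))) r := by
      have h1 := (hY r hr).add (hasDerivAt_velocity_orbit h (hY r hr))
      rw [hfree r hr, sub_zero] at h1
      refine h1.congr_deriv ?_
      rw [selfSimilarTransport_apply, sub_zero, smul_add]
      module
    have hexp : HasDerivAt (fun r : ℝ => Real.exp (-(γ * r))) (-γ * Real.exp (-(γ * r))) r := by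
      have h1 := ((hasDerivAt_id r).const_mul (-γ)).exp
      simp only [id, mul_one, neg_mul] at h1
      convert h1 using 1; ring
    have hp := hexp.smul hZ
    refine hp.congr_deriv ?_
    rw [smul_smul]
    have : Real.exp (-(γ * r)) * γ = -(-γ * Real.exp (-(γ * r))) := by ring
    rw [this, neg_smul, neg_add_cancel]
  exact IsOpen.is_const_of_deriv_eq_zero isOpen_Ioo isPreconnected_Ioo
    (fun r hr => (hderiv r hr).differentiableAt.differentiableWithinAt) (fun r hr => (hderiv r hr).deriv) hs ht

/-- **Free flight, free-fall mode**: on an open interval where `∇P(Y) = 0`, `e^{(1−γ)s} U(Y(s))` is constant (`Z₂ = U(Y) = Ẏ − γY` satisfies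
`Ż₂ = (γ−1) Z₂`). [folklore] -/
theorem freeFlight_mode_fall (h : IsSelfSimilarEulerProfile γ 0 U P) {Y : ℝ → EuclideanSpace ℝ (Fin 3)} {a b : ℝ}
    (hY : ∀ s ∈ Ioo a b, HasDerivAt Y (selfSimilarTransport γ 0 U (Y s)) s) (hfree : ∀ s ∈ Ioo a b, gradient P (Y s) = 0)
    {s t : ℝ} (hs : s ∈ Ioo a b) (ht : t ∈ Ioo a b) :
    Real.exp ((1 - γ) * s) • U (Y s) = Real.exp ((1 - γ) * t) • U (Y t) := by
  have hderiv : ∀ r ∈ Ioo a b, HasDerivAt (fun r => Real.exp ((1 - γ) * r) • U (Y r)) 0 r := by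
    intro r hr
    have hZ : HasDerivAt (fun r => U (Y r)) (-((1 - γ) • U (Y r))) r := by
      have h1 := hasDerivAt_velocity_orbit h (hY r hr)
      rw [hfree r hr, sub_zero] at h1
      exact h1
    have hexp : HasDerivAt (fun r : ℝ => Real.exp ((1 - γ) * r)) ((1 - γ) * Real.exp ((1 - γ) * r)) r := by
      have h1 := ((hasDerivAt_id r).const_mul (1 - γ)).exp
      simp only [id, mul_one] at h1
      convert h1 using 1; ring
    have hp := hexp.smul hZ
    refine hp.congr_deriv ?_
    rw [smul_neg, smul_smul, mul_comm (Real.exp ((1 - γ) * r)) (1 - γ), neg_add_cancel]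
  exact IsOpen.is_const_of_deriv_eq_zero isOpen_Ioo isPreconnected_Ioo
    (fun r hr => (hderiv r hr).differentiableAt.differentiableWithinAt) (fun r hr => (hderiv r hr).deriv) hs ht

/-- **(B5) FREE FLIGHT**: along a forward orbit `Y′ = W(Y)` on an open interval containing `0` where the pressure force vanishes
(`∇P(Y(s)) = 0`), the motion is the explicit two-mode curve `Y(s) = e^{γs}(Y(0) + U(Y(0))) − e^{(γ−1)s} U(Y(0))` (passive drift at rate `γ`,
free fall at rate `γ − 1`). [folklore; cf. ConstantinIgnatovaVicol2026Putative §3.4 eq. (3.19)] -/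
theorem freeFlight (h : IsSelfSimilarEulerProfile γ 0 U P) {Y : ℝ → EuclideanSpace ℝ (Fin 3)} {a b : ℝ}
    (hY : ∀ s ∈ Ioo a b, HasDerivAt Y (selfSimilarTransport γ 0 U (Y s)) s) (hfree : ∀ s ∈ Ioo a b, gradient P (Y s) = 0)
    (h0 : (0 : ℝ) ∈ Ioo a b) {s : ℝ} (hs : s ∈ Ioo a b) :
    Y s = Real.exp (γ * s) • (Y 0 + U (Y 0)) - Real.exp ((γ - 1) * s) • U (Y 0) := by
  have h1 := freeFlight_mode_drift h hY hfree hs h0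
  have h2 := freeFlight_mode_fall h hY hfree hs h0
  simp only [mul_zero, neg_zero, Real.exp_zero, one_smul] at h1 h2
  -- invert the exponential weights
  have e1 : Y s + U (Y s) = Real.exp (γ * s) • (Y 0 + U (Y 0)) := by
    rw [← h1, smul_smul, ← Real.exp_add, show γ * s + -(γ * s) = 0 by ring, Real.exp_zero, one_smul]
  have e2 : U (Y s) = Real.exp ((γ - 1) * s) • U (Y 0) := by
    rw [← h2, smul_smul, ← Real.exp_add, show (γ - 1) * s + (1 - γ) * s = 0 by ring, Real.exp_zero, one_smul]
  calc Y s = (Y s + U (Y s)) - U (Y s) := by abel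
    _ = Real.exp (γ * s) • (Y 0 + U (Y 0)) - Real.exp ((γ - 1) * s) • U (Y 0) := by rw [e1, ← e2]

end Ballistic

end Summit.NavierStokesRegularity.NavierStokesRegularity.Theorems.PowerGaugeEulerLiouville
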